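/-
Copyright (c) 2026 the pub-hodgecm-mathlib formalisation cell (harness21).  Prover seat hodgecm-mathlib-K2E3-p18 (g0), Track B «K2-LIT» ∕ h413, unit U5Kazhdan of the line
`K2_E3_EllipticInputs`: the WILD twin of E1 row 56-B3(55-B) FILE 3-RAM (the 15W∕16W∕17W∕18W engine, mechanical layer; dealer K2E3-plan (g1) DEALS BATCH #2 default for p18).  2026-09-03.
-/
import Summits.HodgeConjecture.HodgeConjecture.Theorems.F0P3cStCharTSBorelDoubleCosetsAtDatumRamified   -- ★ FILE 3-RAM p853571 (+ ED. 2): the tame template + its PLACE-FREE `_of_involution` heads; brings ★ FILE 1-RAM, ★ B-3a bookkeeping, (O) exclusivity `_of_v`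
import Literature.NumberTheory.Automorphic.UnitaryLatticeTreeHorosphereTransversalWild                  -- ★ p855217 (K2E3-p21): (H8) `exists_torusU_mul_unipotentU_…_of_ramified`, (H5)∕(H6) `…_of_ramified` at a ramified quadratic datum of ANY residue characteristic
import Summits.HodgeConjecture.HodgeConjecture.Theorems.F0P3cDyRamWildPlaceDatum                       -- ★ (LH4-p02): `exists_isRamifiedQuadraticDatum_of_placesOver` (the datum at a CM place, ANY uniformiser)
import HarnessLib

/-!
# K2_E3 road (h413 = stmt-HodgeConjecture-24833), unit U5Kazhdan — THE WILD ENGINE, mechanical layer, FILE «B3(55-B)-3-W»: BOREL DOUBLE COSETS AT THE SPECIAL VERTICES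
# `Γ = B · Stab(A 0) = B · Stab(A 1)` and `B ∩ Stab(A m) = (T ∩ Stab(A 0)) · (N ∩ Stab(A m))` on the `U(Φ₃)(L⁺_v)` tree at a RAMIFIED place of ANY residue characteristic
# (the WILD twin of ★ `F0P3cStCharTSBorelDoubleCosetsAtDatumRamified`; Bruhat–Tits 1972 (4.4.3)–(4.4.4), §10)

Cell `pub/hodgecm-mathlib`, crux H413 = `stmt-HodgeConjecture-24833`; lane `--kind proof --supports stmt-HodgeConjecture-24833 --as helper` (THEOREMS ONLY: no definition ∕ instance ∕
notation ∕ named fact ∕ `sorry`; count-neutral).  Dealer K2E3-plan (g1) DEALS BATCH #2 (2026-09-03T22:15:20Z) «**K2E3-p18** (default `Theorems/K2E3BorelDoubleCosetsAtDatumWild.lean` +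
Iwahori)», wild-engine line lead K2E3-p17 (g0); consumer: K2E3-p16's 61b-W `K2E3EPInducedTraceZeroAtDatumDischargeWild` (★ 61b-RAM's call sites «FILE 3∕4 `borelDoubleCoset_{vertex,edge}_of_neg`»).

WHAT.  ★ FILE 3-RAM's three TAME heads `exists_mem_P_mul_of_apply_apartmentEnum_of_neg`, `exists_torus_mul_unipotent_of_mem_P_of_apply_apartmentEnum_of_neg`, `borelDoubleCoset_vertex_of_neg`
re-issued WITHOUT the tame block `(hσϖ : σϖ = −ϖ) (hres) (h2 : |2|_w = 1) (hnorm)`, conclusions VERBATIM, every other binder VERBATIM (`(w hw) {ϖ} (eA heA) {a} (ha) (A hA0 hA1) (t ht τM hτM hτA)`,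
`hm P₀ Pm hP₀ hPm …`):
* §1 `exists_mem_P_mul_of_apply_apartmentEnum_of_horocycleIndex (hσ hvσ hϖ) (hX1v)` — `Γ = B · Stab(A m)`, PLACE-FREE: the ONLY place-sensitive input of the tame proof is FILE 1-RAM's
  horocycle index (X1v) `exists_horocycleIndex_vertices_of_neg`, which enters here as the BINDER `hX1v` (its conclusion VERBATIM) — fed at a wild place by K2E3-p19's dealt twin
  `K2E3HorocyclesAtDatumWild.exists_horocycleIndex_vertices_of_ramified` (BATCH #2), at a tame place by ★ (X1v) `_of_neg`, at an unramified place by ★ B-1 (X1v); the parity argument is the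
  (O) exclusivity ★ `not_exists_latticeGraphIso_apartmentEnum_zero_eq_and_one_eq_of_v` (any involution).
* §2 `exists_torus_mul_unipotent_of_mem_P_of_apply_apartmentEnum_of_ramified (hσ hvσ hϖ heven hd h1d h2t)` — `B ∩ Stab(A m) = (T ∩ Stab(A 0)) · (N ∩ Stab(A m))` at a ramified quadratic
  datum of ANY residue characteristic (letters of ★ `IsRamifiedQuadraticDatum`: fixed elements have even valuation, `v(ϖ − σϖ) = v(ϖ)^d`, `1 ≤ d`, `|2| = |ϖ|^t`): ★ FILE 3-RAM's proof with
  (T-II) (H8) `…_of_neg` ↦ ★ p855217 `exists_torusU_mul_unipotentU_of_mem_borelU_of_latticeGraphIso_apartmentEnum_eq_of_ramified`; and `…_of_ramificationIdx_ne_one (he : e(w∣v) ≠ 1) (hϖ)` at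
  the CM place (the datum by ★ `exists_isRamifiedQuadraticDatum_of_placesOver`, K2E3-p17's 48-W∕1 convention).
* §3 `borelDoubleCoset_vertex_of_horocycleIndex (hσ hvσ hϖ heven hd h1d h2t) (hX1v)` and `borelDoubleCoset_vertex_of_ramificationIdx_ne_one (he) (hϖ) (hX1v)` — the (X3∕X4) (α)-PACKAGE at a
  special vertex `A m`, `m ∈ {0,1}` (the binders `hcover hdisj hT hdec hC` of ★ `Representation.finrank_intertwiningMap_smoothIndRep_eq_sum_finrank_eigen` at the datum), conclusion = ★
  `borelDoubleCoset_vertex_of_neg`'s VERBATIM; compactness by ★ B-3a `isCompact_subgroupOf_M_inf` + FILE 1-RAM `apartmentEnum_eq_self_…_of_involution` (place-free).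
The docking one-liners `borelDoubleCoset_vertex_dock_of_involution` of ★ FILE 3-RAM ED. 2 are already place-free (used BY NAME by the consumer; not re-issued).
HONEST LABEL: count-neutral datum helper of the wild engine (W₁ `sig_K2E3EPNormOneWild` ∕ W₂ ∕ 17W of U5Kazhdan ED. 2); h413 OPEN; HC_CM is proved only modulo the 7 printed citations
(2 remaining named inputs hLiu418 = stmt-HodgeConjecture-24832, h413 = stmt-HodgeConjecture-24833) until rung 0 closes; nothing printed is asserted here.

## References
* [BruhatTits1972] F. Bruhat, J. Tits, *Groupes réductifs sur un corps local I*, Publ. Math. IHÉS 41 (1972), (4.4.3) (Iwasawa), (4.4.4), §10.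
* [Tits1979] J. Tits, *Reductive groups over local fields*, Proc. Sympos. Pure Math. 33.1 (1979), §2.4, §2.7, §2.10 (the ramified `SU₃` tree, any residue characteristic).
* [Rogawski1990] J. D. Rogawski, *Automorphic Representations of Unitary Groups in Three Variables*, Ann. of Math. Stud. 123 (1990), §1.10 p. 9, §4.5 p. 45.
* [Serre1980Trees] J.-P. Serre, *Trees* (1980), Ch. II §1.1, Ch. I §6.4.
* [SchneiderStuhler1997] P. Schneider, U. Stuhler, *Representation theory and sheaves on the Bruhat–Tits building*, Publ. Math. IHÉS 85 (1997), §III.4 (Lemma III.4.13).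
-/

set_option autoImplicit false
-- the mandated namespace has the single-problem summit's repeated segment (`HodgeConjecture.HodgeConjecture`)
set_option linter.dupNamespace false

noncomputable section

open NumberField IsDedekindDomain
open scoped Valued WithZero Matrix MatrixGroups
open Literature.NumberTheory.Rogawski1990 Literature.NumberTheory.Automorphic Literature.NumberTheory.Automorphic.UnitaryGroup
open Literature.NumberTheory.Automorphic.UnitaryLatticeTree Literature.NumberTheory.Automorphic.HermitianLattice
open Literature.NumberTheory.Automorphic.UnitaryThreeFourFrame

namespace Summit.HodgeConjecture.HodgeConjecture.Cruxes.H413.K2E3BorelDoubleCosetsAtDatumWild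

open Summit.HodgeConjecture.HodgeConjecture.Cruxes.H413.F0P3cStCharTSHorocyclesAtDatum
open Summit.HodgeConjecture.HodgeConjecture.Cruxes.H413.F0P3cStCharTSHorocyclesAtDatumRamified
open Summit.HodgeConjecture.HodgeConjecture.Cruxes.H413.F0P3cDyRamWildPlaceDatum

section DoubleCoset

variable (L : Type) [Field L] [NumberField L] [IsCMField L] (v : HeightOneSpectrum (𝓞 ↥(maximalRealSubfield L)))
  (w : PlacesOver L v) (hw : IsCMField.complexConj L • w.1 = w.1) {ϖ : w.1.adicCompletion L}
  (eA : Gqs L v ≃ₜ* ↥(unitaryGroupOfForm (galAdicCompletionMap (L := L) (IsCMField.complexConj L) hw) ((StdForm.antidiagonal 3).over (w.1.adicCompletion L))))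
  (heA : ∀ g : Gqs L v,
    ((eA g : ↥(unitaryGroupOfForm (galAdicCompletionMap (L := L) (IsCMField.complexConj L) hw) ((StdForm.antidiagonal 3).over (w.1.adicCompletion L)))) :
        GL (Fin 3) (w.1.adicCompletion L)) =
      ((localNonsplitEquiv (IsCMField.complexConj L) (qsForm L) (IsCMField.complexConj_ne_one L) w hw g :
        ↥(unitaryGroupOfForm (galAdicCompletionMap (L := L) (IsCMField.complexConj L) hw) (placeForm (qsForm L) w.1))) : GL (Fin 3) (w.1.adicCompletion L)))
  {a : Gqs L v →* ((latticeGraph (galAdicCompletionMap (L := L) (IsCMField.complexConj L) hw) ϖ ((StdForm.antidiagonal 3).over (w.1.adicCompletion L))) ≃g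
    (latticeGraph (galAdicCompletionMap (L := L) (IsCMField.complexConj L) hw) ϖ ((StdForm.antidiagonal 3).over (w.1.adicCompletion L))))}
  (ha : ∀ g, a g = latticeGraphIso (galAdicCompletionMap (L := L) (IsCMField.complexConj L) hw) ϖ ((StdForm.antidiagonal 3).over (w.1.adicCompletion L)) (eA g))
  (A : ℤ → {M : Submodule 𝒪[(w.1.adicCompletion L)] (Fin 3 → (w.1.adicCompletion L)) //
    IsVertex (galAdicCompletionMap (L := L) (IsCMField.complexConj L) hw) ϖ ((StdForm.antidiagonal 3).over (w.1.adicCompletion L)) M})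
  (hA0 : ∀ c : ℤ, (A (2 * c)).1 = latt (Matrix.diagonal ![ϖ ^ c, (1 : w.1.adicCompletion L), ϖ ^ (-c)]))
  (hA1 : ∀ c : ℤ, (A (2 * c + 1)).1 = latt (Matrix.diagonal ![ϖ ^ (c + 1), (1 : w.1.adicCompletion L), ϖ ^ (-c)]))
  (t : ParabolicTriple (Gqs L v)) (ht : t = cmBorelTriple L 3 v)
  (τM : Gqs L v) (hτM : τM ∈ t.M) (hτA : ∀ j : ℤ, a τM (A j) = A (j + 2))

include heA ha hA0 hA1 ht hτM hτA in
set_option maxHeartbeats 1600000 in  -- the datum vertex type (= ★ B-3a's ∕ FILE 3-RAM's budget)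
/-- **`Γ = B · Stab(A m)`, PLACE-FREE given the horocycle index** (★ FILE 3-RAM `exists_mem_P_mul_of_apply_apartmentEnum_of_neg` with its only place-sensitive input, FILE 1-RAM (X1v), as the
binder `hX1v`; conclusion VERBATIM) (`m = 0`: Iwasawa at the hyperspecial vertex; `m = 1`: at the other special vertex): every `y ∈ Gqs L v` is `h · κ` with `h ∈ B(L⁺_v)` and `κ` fixing `A m`.
Proof: `x := y · A m` is `tr x · A (idx x)` (X1v); the parity of `idx x` is that of `m` (the two `U`-orbits of vertices — (O) exclusivity, any involution), so `A (idx x) = τM^c · A m` and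
`h := tr x · τM^c`. [cite: BruhatTits1972, (4.4.3) and §10] [cite: Rogawski1990, §4.5 p. 45] [cite: Serre1980Trees, II.1.1] -/
theorem exists_mem_P_mul_of_apply_apartmentEnum_of_horocycleIndex
    (hσ : ∀ x, (galAdicCompletionMap (L := L) (IsCMField.complexConj L) hw) ((galAdicCompletionMap (L := L) (IsCMField.complexConj L) hw) x) = x)
    (hvσ : ∀ x, Valued.v ((galAdicCompletionMap (L := L) (IsCMField.complexConj L) hw) x) = Valued.v x) (hϖ : Valued.v ϖ = WithZero.exp (-1 : ℤ))
    (hX1v : ∃ (idx : {M : Submodule 𝒪[(w.1.adicCompletion L)] (Fin 3 → (w.1.adicCompletion L)) //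
        IsVertex (galAdicCompletionMap (L := L) (IsCMField.complexConj L) hw) ϖ ((StdForm.antidiagonal 3).over (w.1.adicCompletion L)) M} → ℤ)
      (tr : {M : Submodule 𝒪[(w.1.adicCompletion L)] (Fin 3 → (w.1.adicCompletion L)) //
        IsVertex (galAdicCompletionMap (L := L) (IsCMField.complexConj L) hw) ϖ ((StdForm.antidiagonal 3).over (w.1.adicCompletion L)) M} → Gqs L v),
      (∀ x, tr x ∈ (cmBorelTriple L 3 v : ParabolicTriple (Gqs L v)).N) ∧ (∀ x, a (tr x) (A (idx x)) = x) ∧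
      (∀ n ∈ (cmBorelTriple L 3 v : ParabolicTriple (Gqs L v)).N, ∀ x, idx (a n x) = idx x) ∧ (∀ j : ℤ, idx (A j) = j))
    {m : ℤ} (hm : m = 0 ∨ m = 1) (Pm : Subgroup (Gqs L v)) (hPm : ∀ g, g ∈ Pm ↔ a g (A m) = A m) (y : Gqs L v) :
    ∃ h : Gqs L v, h ∈ t.P ∧ ∃ κ ∈ Pm, y = h * κ := by
  have hN : ∀ g : Gqs L v, g ∈ t.N ↔
      eA g ∈ unipotentU (galAdicCompletionMap (L := L) (IsCMField.complexConj L) hw) ((StdForm.antidiagonal 3).over (w.1.adicCompletion L)) :=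
    fun g => by subst ht; exact mem_cmBorelTriple_N_iff L v w hw eA heA g
  obtain ⟨idx, tr, htrN, htr, -, -⟩ := hX1v
  have htrN' : ∀ x, tr x ∈ t.N := fun x => (hN _).2 (by
    have h := htrN x; subst ht; exact (mem_cmBorelTriple_N_iff L v w hw eA heA _).1 h)
  set x := a y (A m) with hx
  obtain ⟨c, hc⟩ : ∃ c : ℤ, idx x = 2 * c + m := by
    obtain ⟨c, hc | hc⟩ := Int.even_or_odd' (idx x)
    · rcases hm with rfl | rfl
      · exact ⟨c, by rw [hc, add_zero]⟩
      · -- `x` would lie in both vertex orbits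
        exfalso
        refine not_exists_latticeGraphIso_apartmentEnum_zero_eq_and_one_eq_of_v hσ hvσ hϖ A hA0 hA1 x ⟨⟨eA (tr x * τM ^ c), ?_⟩, ⟨eA y, ?_⟩⟩
        · rw [← ha, actionHom_mul_apply L v w hw eA ha, actionHom_zpow_apartmentEnum L v w hw eA ha A τM hτA c 0, zero_add, ← hc, htr]
        · rw [← ha]
    · rcases hm with rfl | rfl
      · exfalso
        refine not_exists_latticeGraphIso_apartmentEnum_zero_eq_and_one_eq_of_v hσ hvσ hϖ A hA0 hA1 x ⟨⟨eA y, ?_⟩, ⟨eA (tr x * τM ^ c), ?_⟩⟩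
        · rw [← ha]
        · rw [← ha, actionHom_mul_apply L v w hw eA ha, actionHom_zpow_apartmentEnum L v w hw eA ha A τM hτA c 1, show (1 : ℤ) + 2 * c = 2 * c + 1 by ring, ← hc, htr]
      · exact ⟨c, hc⟩
  have hh : a (tr x * τM ^ c) (A m) = x := by
    rw [actionHom_mul_apply L v w hw eA ha, actionHom_zpow_apartmentEnum L v w hw eA ha A τM hτA c m, show m + 2 * c = 2 * c + m by ring, ← hc, htr]
  refine ⟨tr x * τM ^ c, mul_mem (t.N_le (htrN' x)) (t.M_le (zpow_mem hτM c)), (tr x * τM ^ c)⁻¹ * y, ?_, by group⟩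
  rw [hPm, actionHom_mul_apply L v w hw eA ha]
  exact actionHom_inv_apply_eq L v w hw eA ha hh

include heA ha hA0 hA1 ht in
/-- **`B ∩ Stab(A m) = (T ∩ Stab(A 0)) · (N ∩ Stab(A m))` at a ramified quadratic datum of ANY residue characteristic** ((T-II) (H8) `_of_ramified` along `eA`; twin of ★ FILE 3-RAM
`exists_torus_mul_unipotent_of_mem_P_of_apply_apartmentEnum_of_neg`, conclusion VERBATIM): a Borel element fixing `A m` is `c · n` with `c ∈ T(L⁺_v)` fixing EVERY apartment vertex and
`n ∈ N(L⁺_v)` fixing `A m`. [cite: BruhatTits1972, §10] [cite: Tits1979, §2.4] [cite: Rogawski1990, §1.10 p. 9] -/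
theorem exists_torus_mul_unipotent_of_mem_P_of_apply_apartmentEnum_of_ramified
    (hσ : ∀ x, (galAdicCompletionMap (L := L) (IsCMField.complexConj L) hw) ((galAdicCompletionMap (L := L) (IsCMField.complexConj L) hw) x) = x)
    (hvσ : ∀ x, Valued.v ((galAdicCompletionMap (L := L) (IsCMField.complexConj L) hw) x) = Valued.v x) (hϖ : Valued.v ϖ = WithZero.exp (-1 : ℤ))
    (heven : ∀ x : (w.1.adicCompletion L), (galAdicCompletionMap (L := L) (IsCMField.complexConj L) hw) x = x → x ≠ 0 → ∃ n : ℤ, Valued.v x = WithZero.exp (2 * n)) {nd nt : ℕ}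
    (hd : Valued.v (ϖ - (galAdicCompletionMap (L := L) (IsCMField.complexConj L) hw) ϖ) = Valued.v ϖ ^ nd) (h1d : 1 ≤ nd) (h2t : Valued.v (2 : (w.1.adicCompletion L)) = Valued.v ϖ ^ nt)
    {b : Gqs L v} (hb : b ∈ t.P) {m : ℤ} (hbm : a b (A m) = A m) :
    ∃ c n : Gqs L v, c ∈ t.M ∧ (∀ k : ℤ, a c (A k) = A k) ∧ n ∈ t.N ∧ a n (A m) = A m ∧ b = c * n := by
  have hM : ∀ g : Gqs L v, g ∈ t.M ↔
      eA g ∈ torusU (galAdicCompletionMap (L := L) (IsCMField.complexConj L) hw) ((StdForm.antidiagonal 3).over (w.1.adicCompletion L)) :=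
    fun g => by subst ht; exact mem_cmBorelTriple_M_iff L v w hw eA heA g
  have hN : ∀ g : Gqs L v, g ∈ t.N ↔
      eA g ∈ unipotentU (galAdicCompletionMap (L := L) (IsCMField.complexConj L) hw) ((StdForm.antidiagonal 3).over (w.1.adicCompletion L)) :=
    fun g => by subst ht; exact mem_cmBorelTriple_N_iff L v w hw eA heA g
  have hP : ∀ g : Gqs L v, g ∈ t.P ↔
      eA g ∈ borelU (galAdicCompletionMap (L := L) (IsCMField.complexConj L) hw) ((StdForm.antidiagonal 3).over (w.1.adicCompletion L)) :=
    fun g => by subst ht; exact mem_cmBorelTriple_P_iff L v w hw eA heA g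
  rw [ha] at hbm
  obtain ⟨tt, n, httT, -, hnN, hbn, -, httA, hnA⟩ :=
    exists_torusU_mul_unipotentU_of_mem_borelU_of_latticeGraphIso_apartmentEnum_eq_of_ramified hσ hvσ hϖ heven hd h1d h2t A hA0 hA1 ((hP b).1 hb) hbm
  refine ⟨eA.symm tt, eA.symm n, (hM _).2 ?_, fun k => ?_, (hN _).2 ?_, ?_, ?_⟩
  · rw [ContinuousMulEquiv.apply_symm_apply]; exact httT
  · rw [ha, ContinuousMulEquiv.apply_symm_apply]; exact httA k
  · rw [ContinuousMulEquiv.apply_symm_apply]; exact hnN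
  · rw [ha, ContinuousMulEquiv.apply_symm_apply]; exact hnA
  · apply eA.injective; rw [map_mul, ContinuousMulEquiv.apply_symm_apply, ContinuousMulEquiv.apply_symm_apply]; exact hbn

include heA ha hA0 hA1 ht in
/-- **The same at the CM place `w ∣ v`, RAMIFIED (`e(w∣v) ≠ 1`), any uniformiser `ϖ` of `L_w`** (the datum by ★ `exists_isRamifiedQuadraticDatum_of_placesOver`; K2E3-p17's 48-W∕1
`_of_ramificationIdx_ne_one` convention). [cite: BruhatTits1972, §10] [cite: Tits1979, §2.4] -/
theorem exists_torus_mul_unipotent_of_mem_P_of_apply_apartmentEnum_of_ramificationIdx_ne_one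
    (he : v.asIdeal.ramificationIdx' w.1.asIdeal ≠ 1) (hϖ : Valued.v ϖ = WithZero.exp (-1 : ℤ))
    {b : Gqs L v} (hb : b ∈ t.P) {m : ℤ} (hbm : a b (A m) = A m) :
    ∃ c n : Gqs L v, c ∈ t.M ∧ (∀ k : ℤ, a c (A k) = A k) ∧ n ∈ t.N ∧ a n (A m) = A m ∧ b = c * n := by
  obtain ⟨nd, nt, hD⟩ := exists_isRamifiedQuadraticDatum_of_placesOver L w hw he ϖ hϖ
  obtain ⟨hσ, hvσ, -, heven, hd, h1d, h2t⟩ := hD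
  exact exists_torus_mul_unipotent_of_mem_P_of_apply_apartmentEnum_of_ramified L v w hw eA heA ha A hA0 hA1 t ht hσ hvσ hϖ heven hd h1d h2t hb hbm

/-! ### §3 The (X3∕X4) (α)-package at a special vertex, at a ramified quadratic datum of any residue characteristic -/

include heA ha hA0 hA1 ht hτM hτA in
set_option maxHeartbeats 1600000 in  -- the datum vertex type (= ★ B-3a's budget)
/-- **(X3∕X4) THE (α) PACKAGE AT A SPECIAL VERTEX `A m`, `m ∈ {0,1}`, at a ramified quadratic datum of ANY residue characteristic** (twin of ★ FILE 3-RAM `borelDoubleCoset_vertex_of_neg`: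
its tame block replaced by the datum letters `(heven hd h1d h2t)` + the horocycle-index binder `hX1v`; conclusion VERBATIM) (`ι := Unit`, `g := 1`, `H := B = t.P`, `K := Stab(A m)`,
`T () := B ⊓ K`, `C () := (T ∩ Stab(A 0)).subgroupOf (B ⊓ K)`, `N () := t.N.subgroupOf (B ⊓ K)`): the binders `hcover hdisj hT hdec hC` of ★
`Representation.finrank_intertwiningMap_smoothIndRep_eq_sum_finrank_eigen` at the datum, token for token after that instantiation.
[cite: BruhatTits1972, (4.4.3)–(4.4.4) and §10] [cite: Tits1979, §2.4] [cite: Rogawski1990, §1.10 p. 9; §4.5 p. 45] [cite: SchneiderStuhler1997, §III.4] -/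
theorem borelDoubleCoset_vertex_of_horocycleIndex
    (hσ : ∀ x, (galAdicCompletionMap (L := L) (IsCMField.complexConj L) hw) ((galAdicCompletionMap (L := L) (IsCMField.complexConj L) hw) x) = x)
    (hvσ : ∀ x, Valued.v ((galAdicCompletionMap (L := L) (IsCMField.complexConj L) hw) x) = Valued.v x) (hϖ : Valued.v ϖ = WithZero.exp (-1 : ℤ))
    (heven : ∀ x : (w.1.adicCompletion L), (galAdicCompletionMap (L := L) (IsCMField.complexConj L) hw) x = x → x ≠ 0 → ∃ n : ℤ, Valued.v x = WithZero.exp (2 * n)) {nd nt : ℕ}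
    (hd : Valued.v (ϖ - (galAdicCompletionMap (L := L) (IsCMField.complexConj L) hw) ϖ) = Valued.v ϖ ^ nd) (h1d : 1 ≤ nd) (h2t : Valued.v (2 : (w.1.adicCompletion L)) = Valued.v ϖ ^ nt)
    (hX1v : ∃ (idx : {M : Submodule 𝒪[(w.1.adicCompletion L)] (Fin 3 → (w.1.adicCompletion L)) //
        IsVertex (galAdicCompletionMap (L := L) (IsCMField.complexConj L) hw) ϖ ((StdForm.antidiagonal 3).over (w.1.adicCompletion L)) M} → ℤ)
      (tr : {M : Submodule 𝒪[(w.1.adicCompletion L)] (Fin 3 → (w.1.adicCompletion L)) //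
        IsVertex (galAdicCompletionMap (L := L) (IsCMField.complexConj L) hw) ϖ ((StdForm.antidiagonal 3).over (w.1.adicCompletion L)) M} → Gqs L v),
      (∀ x, tr x ∈ (cmBorelTriple L 3 v : ParabolicTriple (Gqs L v)).N) ∧ (∀ x, a (tr x) (A (idx x)) = x) ∧
      (∀ n ∈ (cmBorelTriple L 3 v : ParabolicTriple (Gqs L v)).N, ∀ x, idx (a n x) = idx x) ∧ (∀ j : ℤ, idx (A j) = j))
    {m : ℤ} (hm : m = 0 ∨ m = 1) (P₀ Pm : Subgroup (Gqs L v)) (hP₀ : ∀ g, g ∈ P₀ ↔ a g (A 0) = A 0) (hPm : ∀ g, g ∈ Pm ↔ a g (A m) = A m) :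
    (∀ y : Gqs L v, ∃ _ : Unit, ∃ h : ↥t.P, ∃ κ ∈ Pm, y = (h : Gqs L v) * 1 * κ) ∧
    (∀ i j : Unit, (∃ h : ↥t.P, ∃ κ ∈ Pm, (1 : Gqs L v) = (h : Gqs L v) * 1 * κ) → i = j) ∧
    (∀ (_ : Unit) (y : Gqs L v), y ∈ t.P ⊓ Pm ↔ y ∈ t.P ∧ (1 : Gqs L v)⁻¹ * y * 1 ∈ Pm) ∧
    (∀ (_ : Unit) (x : ↥(t.P ⊓ Pm)), ∃ c ∈ (t.M ⊓ P₀).subgroupOf (t.P ⊓ Pm), ∃ n ∈ t.N.subgroupOf (t.P ⊓ Pm), x = c * n) ∧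
    (∀ _ : Unit, IsCompact (((t.M ⊓ P₀).subgroupOf (t.P ⊓ Pm) : Subgroup ↥(t.P ⊓ Pm)) : Set ↥(t.P ⊓ Pm))) := by
  refine ⟨fun y => ?_, fun _ _ _ => Subsingleton.elim _ _, fun _ y => by rw [Subgroup.mem_inf, inv_one, one_mul, mul_one], fun _ x => ?_, fun _ => ?_⟩
  · obtain ⟨h, hh, κ, hκ, hy⟩ := exists_mem_P_mul_of_apply_apartmentEnum_of_horocycleIndex L v w hw eA heA ha A hA0 hA1 t ht τM hτM hτA hσ hvσ hϖ hX1v hm Pm hPm y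
    exact ⟨(), ⟨h, hh⟩, κ, hκ, by rw [mul_one]; exact hy⟩
  · obtain ⟨c, n, hcM, hcA, hnN, hnA, hx⟩ :=
      exists_torus_mul_unipotent_of_mem_P_of_apply_apartmentEnum_of_ramified L v w hw eA heA ha A hA0 hA1 t ht hσ hvσ hϖ heven hd h1d h2t (Subgroup.mem_inf.1 x.2).1 ((hPm x).1 (Subgroup.mem_inf.1 x.2).2)
    have htP : t.M ≤ t.P := t.M_le
    have hNP : t.N ≤ t.P := t.N_le
    refine ⟨⟨c, Subgroup.mem_inf.2 ⟨htP hcM, (hPm c).2 (hcA m)⟩⟩, Subgroup.mem_subgroupOf.2 (Subgroup.mem_inf.2 ⟨hcM, (hP₀ c).2 (hcA 0)⟩),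
      ⟨n, Subgroup.mem_inf.2 ⟨hNP hnN, (hPm n).2 hnA⟩⟩, Subgroup.mem_subgroupOf.2 hnN, Subtype.ext hx⟩
  · refine isCompact_subgroupOf_M_inf L v w hw eA heA ha t ht P₀ (A 0) hP₀ _ fun c hc => Subgroup.mem_inf.2 ⟨t.M_le (Subgroup.mem_inf.1 hc).1, (hPm c).2 ?_⟩
    have hcM : c ∈ (cmBorelTriple L 3 v : ParabolicTriple (Gqs L v)).M := by have h := (Subgroup.mem_inf.1 hc).1; subst ht; exact h
    exact apartmentEnum_eq_self_of_mem_cmBorelTriple_M_of_apply_zero_of_involution L v w hw eA heA ha A hA0 hA1 hσ hvσ hϖ hcM ((hP₀ c).1 (Subgroup.mem_inf.1 hc).2) m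

include heA ha hA0 hA1 ht hτM hτA in
set_option maxHeartbeats 1600000 in  -- the datum vertex type
/-- **(X3∕X4) THE (α) PACKAGE AT A SPECIAL VERTEX, at the CM place `w ∣ v`, RAMIFIED (`e(w∣v) ≠ 1`), any uniformiser** — the 61b-W call shape: `(he) (hϖ) (hX1v) (hm) (P₀ Pm hP₀ hPm)`,
`hX1v` := K2E3-p19's `exists_horocycleIndex_vertices_of_ramified …` (or ★ (X1v) `_of_neg` at a tame place).  Conclusion VERBATIM = ★ `borelDoubleCoset_vertex_of_neg`'s.
[cite: BruhatTits1972, (4.4.3)–(4.4.4) and §10] [cite: Tits1979, §2.4] [cite: SchneiderStuhler1997, §III.4] -/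
theorem borelDoubleCoset_vertex_of_ramificationIdx_ne_one
    (he : v.asIdeal.ramificationIdx' w.1.asIdeal ≠ 1) (hϖ : Valued.v ϖ = WithZero.exp (-1 : ℤ))
    (hX1v : ∃ (idx : {M : Submodule 𝒪[(w.1.adicCompletion L)] (Fin 3 → (w.1.adicCompletion L)) //
        IsVertex (galAdicCompletionMap (L := L) (IsCMField.complexConj L) hw) ϖ ((StdForm.antidiagonal 3).over (w.1.adicCompletion L)) M} → ℤ)
      (tr : {M : Submodule 𝒪[(w.1.adicCompletion L)] (Fin 3 → (w.1.adicCompletion L)) //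
        IsVertex (galAdicCompletionMap (L := L) (IsCMField.complexConj L) hw) ϖ ((StdForm.antidiagonal 3).over (w.1.adicCompletion L)) M} → Gqs L v),
      (∀ x, tr x ∈ (cmBorelTriple L 3 v : ParabolicTriple (Gqs L v)).N) ∧ (∀ x, a (tr x) (A (idx x)) = x) ∧
      (∀ n ∈ (cmBorelTriple L 3 v : ParabolicTriple (Gqs L v)).N, ∀ x, idx (a n x) = idx x) ∧ (∀ j : ℤ, idx (A j) = j))
    {m : ℤ} (hm : m = 0 ∨ m = 1) (P₀ Pm : Subgroup (Gqs L v)) (hP₀ : ∀ g, g ∈ P₀ ↔ a g (A 0) = A 0) (hPm : ∀ g, g ∈ Pm ↔ a g (A m) = A m) :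
    (∀ y : Gqs L v, ∃ _ : Unit, ∃ h : ↥t.P, ∃ κ ∈ Pm, y = (h : Gqs L v) * 1 * κ) ∧
    (∀ i j : Unit, (∃ h : ↥t.P, ∃ κ ∈ Pm, (1 : Gqs L v) = (h : Gqs L v) * 1 * κ) → i = j) ∧
    (∀ (_ : Unit) (y : Gqs L v), y ∈ t.P ⊓ Pm ↔ y ∈ t.P ∧ (1 : Gqs L v)⁻¹ * y * 1 ∈ Pm) ∧
    (∀ (_ : Unit) (x : ↥(t.P ⊓ Pm)), ∃ c ∈ (t.M ⊓ P₀).subgroupOf (t.P ⊓ Pm), ∃ n ∈ t.N.subgroupOf (t.P ⊓ Pm), x = c * n) ∧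
    (∀ _ : Unit, IsCompact (((t.M ⊓ P₀).subgroupOf (t.P ⊓ Pm) : Subgroup ↥(t.P ⊓ Pm)) : Set ↥(t.P ⊓ Pm))) := by
  obtain ⟨nd, nt, hD⟩ := exists_isRamifiedQuadraticDatum_of_placesOver L w hw he ϖ hϖ
  obtain ⟨hσ, hvσ, -, heven, hd, h1d, h2t⟩ := hD
  exact borelDoubleCoset_vertex_of_horocycleIndex L v w hw eA heA ha A hA0 hA1 t ht τM hτM hτA hσ hvσ hϖ heven hd h1d h2t hX1v hm P₀ Pm hP₀ hPm

end DoubleCoset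

end Summit.HodgeConjecture.HodgeConjecture.Cruxes.H413.K2E3BorelDoubleCosetsAtDatumWild

end
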